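import Summits.Langlands.Langlands.Theses.EisensteinMonodromy
import Summits.Langlands.Langlands.Theorems.EisensteinMonodromyEnvelopeCompressionWD
import Literature.NumberTheory.GaloisRepresentations.TwistedSumDecompositionProofs
import Literature.NumberTheory.GaloisRepresentations.FrobeniusDensity
import Literature.NumberTheory.Automorphic.ChebotarevArtinRepHolds
import Literature.NumberTheory.Automorphic.HarrisLanTaylorThorneThm713
import Literature.NumberTheory.Automorphic.SatakeParamNeZeroProofs
import Literature.NumberTheory.Automorphic.AutomorphicRepsGLSatakeFlathProofs
import Literature.RepresentationTheory.Semisimple.Twist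
import Literature.RepresentationTheory.Semisimple.Multiplicity
import Literature.RepresentationTheory.Semisimple.EquivOfCharacter
import Literature.RepresentationTheory.FiniteGroups.EquivOfCharacter
import HarnessLib

/-!
# EisensteinMonodromy — `EnvelopeToTarget` (stmt-Langlands-2375), proved outright

`Summit.Langlands.Langlands.Theses.EisensteinMonodromy.EnvelopeToTarget :
EisensteinEnvelopeGeneric → GenericMonodromy`.

Given the generic-fibre conclusion for the Eisenstein envelopes `R_N : Γ_K → GL_{2n}(ℚ̄_p)` of
`π` (hypothesis) and a semisimple `ρ : Γ_K → GL_n(ℚ̄_p)` with the Frobenius characteristic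
polynomials of `π` at almost all places, we show `WD(ρ|_{Γ_{K_v}})` exists by the
Grothendieck–Deligne recipe and is generic, for every `v ∤ p`:

* §6.1 (`exists_summand_of_trace`, pure representation theory): if `tr R = tr ρ + χ · tr ρ₂` with
  `R, ρ, ρ₂` semisimple then `ρ` is a summand of `R` cut out by matrices `(I, P)`, `P I = 1`
  (characters of `ρ ⊕ ρ₂ ⊗ χ`, Bourbaki's "same character ⇒ equivalent" for semisimple
  representations, `Literature.RepresentationTheory.Semisimple`);
* §6.2 (`exists_trace_decomposition`, the printed proof of HLTT Thm. 7.13 run on `Γ_K`):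
  Prop. 7.12 (`prop712Hausdorff_holds`, PROVED in the tree) applied to the family `R_N`, the
  character `μ = ε_p^{-2}` (`muS`) and the dense set of Frobenii outside a finite bad set
  (`absoluteGaloisGroup.frobenius_dense`, from the proved Chebotarev `chebotarev_artinRep_holds`)
  yields a semisimple `ρ₂` with `tr R_N = tr ρ + μ^N · tr ρ₂` on Frobenii, hence everywhere;
* §6.3 (`envelopeToTarget`): restrict to `W_{K_v}` and apply the recipe/genericity transfer
  `exists_isWeilDeligneOfLadic_of_summand` of `EisensteinMonodromyEnvelopeCompressionWD`
  (rank `0` is the degenerate instance `I = P = 0` of the same lemma).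

Everything used is proved in the tree (no named-fact hypotheses); axioms standard.
[cite: HarrisLanTaylorThorneRMS2016, proof of Thm. 7.13 (p. 232)]
-/

set_option linter.dupNamespace false

noncomputable section

namespace Summit.Langlands.Langlands.Theorems.EisensteinMonodromyEnvelopeToTarget

open scoped NumberField Polynomial
open IsDedekindDomain NumberField Field Polynomial
open Literature.NumberTheory.GaloisRepresentations Literature.NumberTheory.Automorphic
open Literature.NumberTheory.Automorphic.HarrisLanTaylorThorne2016
open Summit.Langlands.Langlands.Theorems.EisensteinMonodromyEnvelopeCompression
  (exists_isWeilDeligneOfLadic_of_summand)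

/-! ### §6.1 Framed representations: matrices, characters, summands from traces -/

section Framed

variable {G : Type*} [Group G] [TopologicalSpace G] {k : Type*} [Field k] [TopologicalSpace k]
  {d : ℕ}

/-- The matrix of `r.toRepresentation g` in the standard basis is `r g`. [folklore] -/
theorem toMatrix'_toRepresentation (r : FramedRep G k d) (g : G) :
    LinearMap.toMatrix' (r.toRepresentation g) =
      ((r g : GL (Fin d) k) : Matrix (Fin d) (Fin d) k) := by
  have h : r.toRepresentation g =
      Matrix.toLin' ((r g : GL (Fin d) k) : Matrix (Fin d) (Fin d) k) :=
    LinearMap.ext fun v ↦ by rw [FramedRep.toRepresentation_apply_apply, Matrix.toLin'_apply]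
  rw [h, LinearMap.toMatrix'_toLin']

/-- The character of `r.toRepresentation` is the matrix trace `FramedRep.trace r`
(Mathlib `Matrix.trace_toLin'_eq`). [folklore] -/
theorem character_toRepresentation (r : FramedRep G k d) (g : G) :
    r.toRepresentation.character g = FramedRep.trace r g := by
  change LinearMap.trace _ _ (r.toRepresentation g) = _
  have h : r.toRepresentation g =
      Matrix.toLin' ((r g : GL (Fin d) k) : Matrix (Fin d) (Fin d) k) :=
    LinearMap.ext fun v ↦ by rw [FramedRep.toRepresentation_apply_apply, Matrix.toLin'_apply]
  rw [h, Matrix.trace_toLin'_eq]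
  rfl

/-- **A summand from a trace identity.** If `R, ρ, ρ₂` are semisimple framed representations
over a field of characteristic `0` with `tr R = tr ρ + χ · tr ρ₂` for a character `χ`, then `ρ` is
a summand of `R`: there are matrices `I` (`m × d`) and `P` (`d × m`) with `P I = 1`,
`R(g) I = I ρ(g)` and `P R(g) = ρ(g) P` — from an equivalence `R ≃ ρ ⊕ (ρ₂ ⊗ χ)` (same
character, Bourbaki A VIII §20 n°6 via
`Literature.RepresentationTheory.Semisimple.Representation.nonempty_equiv_of_character_eq_of_isSemisimple`).
[folklore] -/
theorem exists_summand_of_trace [CharZero k] {m d' : ℕ} (R : FramedRep G k m)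
    (ρ : FramedRep G k d) (ρ₂ : FramedRep G k d') (χ : G →* kˣ)
    (hR : R.toRepresentation.IsSemisimpleRepresentation)
    (hρ : ρ.toRepresentation.IsSemisimpleRepresentation)
    (hρ₂ : ρ₂.toRepresentation.IsSemisimpleRepresentation)
    (htr : ∀ g, FramedRep.trace R g =
      FramedRep.trace ρ g + ((χ g : kˣ) : k) * FramedRep.trace ρ₂ g) :
    ∃ (I : Matrix (Fin m) (Fin d) k) (P : Matrix (Fin d) (Fin m) k), P * I = 1 ∧
      (∀ g, ((R g : GL (Fin m) k) : Matrix (Fin m) (Fin m) k) * I =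
        I * ((ρ g : GL (Fin d) k) : Matrix (Fin d) (Fin d) k)) ∧
      (∀ g, P * ((R g : GL (Fin m) k) : Matrix (Fin m) (Fin m) k) =
        ((ρ g : GL (Fin d) k) : Matrix (Fin d) (Fin d) k) * P) := by
  classical
  set τ := Literature.RepresentationTheory.Semisimple.Representation.twist ρ₂.toRepresentation χ
    with hτ
  have hchar : R.toRepresentation.character = (ρ.toRepresentation.prod τ).character := by
    funext g
    rw [Literature.RepresentationTheory.FiniteGroups.Representation.char_prod, Pi.add_apply, hτ,
      Literature.RepresentationTheory.Semisimple.Representation.character_twist,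
      character_toRepresentation, character_toRepresentation, character_toRepresentation, htr g]
  haveI := hR
  haveI := hρ
  haveI := hρ₂
  obtain ⟨φ⟩ :=
    Literature.RepresentationTheory.Semisimple.Representation.nonempty_equiv_of_character_eq_of_isSemisimple
      _ _ hchar
  -- the linear isomorphism `L : k^m ≃ k^d × k^{d'}` and its equivariance, pointwise
  have hL : ∀ g v, φ.toLinearEquiv (R.toRepresentation g v) =
      (ρ.toRepresentation.prod τ) g (φ.toLinearEquiv v) :=
    fun g v ↦ Literature.RepresentationTheory.FiniteGroups.Representation.Equiv.apply_apply φ g v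
  have hLs : ∀ g w, φ.toLinearEquiv.symm ((ρ.toRepresentation.prod τ) g w) =
      R.toRepresentation g (φ.toLinearEquiv.symm w) := by
    intro g w
    apply φ.toLinearEquiv.injective
    rw [LinearEquiv.apply_symm_apply, hL, LinearEquiv.apply_symm_apply]
  have hprod : ∀ g (x : Fin d → k) (y : Fin d' → k),
      (ρ.toRepresentation.prod τ) g (x, y) = (ρ.toRepresentation g x, τ g y) := fun g x y ↦ rfl
  have hprod₁ : ∀ g (w : (Fin d → k) × (Fin d' → k)),
      ((ρ.toRepresentation.prod τ) g w).1 = ρ.toRepresentation g w.1 := fun g w ↦ rfl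
  -- the inclusion `Iₗ` of and projection `Pₗ` onto the first summand, transported to `k^m`
  set Iₗ : (Fin d → k) →ₗ[k] (Fin m → k) :=
    (φ.toLinearEquiv.symm : _ →ₗ[k] (Fin m → k)) ∘ₗ LinearMap.inl k (Fin d → k) (Fin d' → k)
    with hIₗ
  set Pₗ : (Fin m → k) →ₗ[k] (Fin d → k) :=
    LinearMap.fst k (Fin d → k) (Fin d' → k) ∘ₗ (φ.toLinearEquiv : (Fin m → k) →ₗ[k] _) with hPₗ
  have hIₗ_apply : ∀ x, Iₗ x = φ.toLinearEquiv.symm (x, 0) := fun x ↦ rfl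
  have hPₗ_apply : ∀ v, Pₗ v = (φ.toLinearEquiv v).1 := fun v ↦ rfl
  have hPIₗ : Pₗ ∘ₗ Iₗ = LinearMap.id := by
    apply LinearMap.ext
    intro x
    rw [LinearMap.comp_apply, hIₗ_apply, hPₗ_apply, LinearEquiv.apply_symm_apply]
    rfl
  have hRIₗ : ∀ g, R.toRepresentation g ∘ₗ Iₗ = Iₗ ∘ₗ ρ.toRepresentation g := by
    intro g
    apply LinearMap.ext
    intro x
    show R.toRepresentation g (Iₗ x) = Iₗ (ρ.toRepresentation g x)
    rw [hIₗ_apply, hIₗ_apply, ← hLs, hprod, map_zero]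
  have hPRₗ : ∀ g, Pₗ ∘ₗ R.toRepresentation g = ρ.toRepresentation g ∘ₗ Pₗ := by
    intro g
    apply LinearMap.ext
    intro v
    show Pₗ (R.toRepresentation g v) = ρ.toRepresentation g (Pₗ v)
    rw [hPₗ_apply, hPₗ_apply, hL, hprod₁]
  -- matrices
  refine ⟨LinearMap.toMatrix' Iₗ, LinearMap.toMatrix' Pₗ, ?_, fun g ↦ ?_, fun g ↦ ?_⟩
  · rw [← LinearMap.toMatrix'_comp, hPIₗ, LinearMap.toMatrix'_id]
  · rw [← toMatrix'_toRepresentation, ← toMatrix'_toRepresentation, ← LinearMap.toMatrix'_comp,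
      ← LinearMap.toMatrix'_comp, hRIₗ]
  · rw [← toMatrix'_toRepresentation, ← toMatrix'_toRepresentation, ← LinearMap.toMatrix'_comp,
      ← LinearMap.toMatrix'_comp, hPRₗ]

end Framed

/-! ### §6.2 The trace decomposition `tr R_N = tr ρ + μ^N · tr ρ₂` (HLTT Prop. 7.12 on `Γ_K`) -/

section Global

open scoped Classical -- the place subtypes indexing `mixedSpace K` are `Fintype` classically
-- (`NormedCommRing (mixedSpace K)`, needed to write `AutomorphyDatum.gl n K hcpt`)

variable {n : ℕ} {K : Type} [Field K] [NumberField K] {hcpt : isCompact_glFiniteIntegralLevel n K}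
  (p : ℕ) [Fact p.Prime]

/-- The places above `p` are finite in number (Mathlib `Ideal.finite_factors`). [folklore] -/
theorem eventually_not_mem_asIdeal :
    ∀ᶠ v : HeightOneSpectrum (𝓞 K) in Filter.cofinite, ((p : ℕ) : 𝓞 K) ∉ v.asIdeal := by
  have hp : p.Prime := Fact.out
  rw [Filter.eventually_cofinite]
  simp only [not_not]
  have hne : Ideal.span {((p : ℕ) : 𝓞 K)} ≠ ⊥ := by
    rw [Ne, Ideal.span_singleton_eq_bot]
    exact_mod_cast hp.ne_zero
  convert Ideal.finite_factors hne using 2 with v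
  simp [Ideal.dvd_span_singleton]

/-- **Trace decomposition of the envelopes.**  Let `R_N : Γ_K → GL_{2n}(ℚ̄_p)` (`N ≥ N₀`,
semisimple) have arithmetic Frobenius characteristic polynomials
`arithFrobPolyOfSatake ı q_v n α · ∏_{b ∈ B_v} (X - b q_v^{-2N})` at almost all places, with
`B_v ∌ 0` of size `n`, and let the semisimple `ρ : Γ_K → GL_n(ℚ̄_p)` have Frobenius characteristic
polynomials `arithFrobPolyOfSatake ı q_v n α` at almost all places (`n > 0`).  Then for every
`N ≥ N₀` there are a character `χ` (namely `μ^N`, `μ = ε_p^{-2}`) and a semisimple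
`ρ₂ : Γ_K → GL_n(ℚ̄_p)` with `tr R_N = tr ρ + χ · tr ρ₂` on all of `Γ_K`.  This is the printed
proof of HLTT Thm. 7.13 (p. 232) — Prop. 7.12 (`prop712Hausdorff_holds`) for `Γ = Γ_K`,
`μ = ε_p^{-2}`, `𝔉` the Frobenii outside the finite bad set (dense by Chebotarev,
`absoluteGaloisGroup.frobenius_dense`), `ℳ = [N₀, ∞)` — followed by "trace = sum of roots" on
`𝔉` and continuity. [cite: HarrisLanTaylorThorneRMS2016, proof of Thm. 7.13 (p. 232)] -/
theorem exists_trace_decomposition (hn : 0 < n) (π : AutomorphicRepData (AutomorphyDatum.gl n K hcpt))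
    (ι : PadicAlgCl p ≃+* ℂ) {N₀ : ℕ} {R : ℕ → FramedGaloisRep K (PadicAlgCl p) (2 * n)}
    {B : HeightOneSpectrum (𝓞 K) → Multiset (PadicAlgCl p)}
    (hRss : ∀ N, N₀ ≤ N → (R N).toGaloisRep.IsSemisimple)
    (hB : ∀ v, Multiset.card (B v) = n ∧ (0 : PadicAlgCl p) ∉ B v)
    (hRv : ∀ᶠ v : HeightOneSpectrum (𝓞 K) in Filter.cofinite, ∀ α : Multiset ℂ,
      π.HasSatakeParamAt v α → ∀ N, N₀ ≤ N → (R N).IsUnramifiedAt v ∧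
        (R N).HasFrobCharpolyAt v (arithFrobPolyOfSatake ι v.residueCard n α *
          ((B v).map fun b ↦ X - C (b * ((v.residueCard : PadicAlgCl p)⁻¹) ^ (2 * N))).prod))
    (ρ : FramedGaloisRep K (PadicAlgCl p) n)
    (h5 : ∀ᶠ v : HeightOneSpectrum (𝓞 K) in Filter.cofinite, ∀ α : Multiset ℂ,
      π.HasSatakeParamAt v α → ρ.IsUnramifiedAt v ∧
        ρ.HasFrobCharpolyAt v (arithFrobPolyOfSatake ι v.residueCard n α))
    {N : ℕ} (hN : N₀ ≤ N) :
    ∃ (χ : absoluteGaloisGroup K →* (PadicAlgCl p)ˣ) (ρ₂ : FramedGaloisRep K (PadicAlgCl p) n),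
      ρ₂.toGaloisRep.IsSemisimple ∧ ∀ σ, FramedRep.trace (R N) σ =
        FramedRep.trace ρ σ + ((χ σ : (PadicAlgCl p)ˣ) : PadicAlgCl p) * FramedRep.trace ρ₂ σ := by
  classical
  -- the finite bad set `S` and the good properties outside it
  have hG := h5.and (hRv.and ((AutomorphicRepData.hasSatakeParamAt_cofinite_holds π).and
    (eventually_not_mem_asIdeal (K := K) p)))
  obtain ⟨S, hSfin, hgood⟩ : ∃ S : Set (HeightOneSpectrum (𝓞 K)), S.Finite ∧ ∀ v ∉ S,
      (∀ α : Multiset ℂ, π.HasSatakeParamAt v α → ρ.IsUnramifiedAt v ∧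
        ρ.HasFrobCharpolyAt v (arithFrobPolyOfSatake ι v.residueCard n α)) ∧
      (∀ α : Multiset ℂ, π.HasSatakeParamAt v α → ∀ N, N₀ ≤ N → (R N).IsUnramifiedAt v ∧
        (R N).HasFrobCharpolyAt v (arithFrobPolyOfSatake ι v.residueCard n α *
          ((B v).map fun b ↦ X - C (b * ((v.residueCard : PadicAlgCl p)⁻¹) ^ (2 * N))).prod)) ∧
      π.IsUnramifiedAt v ∧ ((p : ℕ) : 𝓞 K) ∉ v.asIdeal :=
    ⟨_, Filter.eventually_cofinite.1 hG, fun v hv ↦ not_not.1 hv⟩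
  have hSp : ∀ v ∉ S, ((p : ℕ) : 𝓞 K) ∉ v.asIdeal := fun v hv ↦ (hgood v hv).2.2.2
  -- `μ = ε_p^{-2}` on `Γ_K` and the dense set `𝔉` of Frobenii outside `S`
  set μ : absoluteGaloisGroup K →ₜ* (PadicAlgCl p)ˣ :=
    (muS p S hSp).comp ⟨QuotientGroup.mk' _, continuous_quot_mk⟩ with hμdef
  have hμ : ∀ σ, μ σ = muS p S hSp (QuotientGroup.mk σ) := fun σ ↦ rfl
  set 𝔉 : Set (absoluteGaloisGroup K) :=
    {σ | ∃ v ∉ S, ∃ 𝔓 ∈ v.primesAbove, IsArithFrobAt (𝓞 K) σ 𝔓} with h𝔉def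
  have h𝔉 : Dense 𝔉 := absoluteGaloisGroup.frobenius_dense chebotarev_artinRep_holds K S hSfin
  have hμord : ∀ f ∈ 𝔉, ¬ IsOfFinOrder (μ f) := by
    rintro σ ⟨v, hv, 𝔓, h𝔓, hσ⟩
    rw [hμ]
    exact not_isOfFinOrder_muS_mk p S hSp hv h𝔓 hσ
  -- chosen place / prime / Satake parameter for each Frobenius in `𝔉`
  have hwit : ∀ f ∈ 𝔉, ∃ (v : HeightOneSpectrum (𝓞 K)) (𝔓 : Ideal (absIntegers (𝓞 K) K))
      (α : Multiset ℂ), v ∉ S ∧ 𝔓 ∈ v.primesAbove ∧ IsArithFrobAt (𝓞 K) f 𝔓 ∧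
        π.HasSatakeParamAt v α := by
    rintro σ ⟨v, hv, 𝔓, h𝔓, hσ⟩
    obtain ⟨α, hα⟩ := (hgood v hv).2.2.1
    exact ⟨v, 𝔓, α, hv, h𝔓, hσ, hα⟩
  haveI : Nonempty (HeightOneSpectrum (𝓞 K)) := by
    obtain ⟨𝔪, h𝔪⟩ := Ideal.exists_maximal (𝓞 K)
    exact ⟨⟨𝔪, h𝔪.isPrime,
      Ring.ne_bot_of_isMaximal_of_not_isField h𝔪 (RingOfIntegers.not_isField K)⟩⟩
  choose! wv w𝔓 wα hwS hw𝔓 hwσ hwα using hwit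
  -- the root multisets
  set E₁ : HeightOneSpectrum (𝓞 K) → Multiset ℂ → Multiset (PadicAlgCl p) := fun v α ↦
    (arithFrobPolyOfSatake ι v.residueCard n α).roots with hE₁def
  set 𝔈₁ : absoluteGaloisGroup K → Multiset (PadicAlgCl p) := fun f ↦ E₁ (wv f) (wα f) with h𝔈₁def
  set 𝔈₂ : absoluteGaloisGroup K → Multiset (PadicAlgCl p) := fun f ↦ B (wv f) with h𝔈₂def
  have h𝔈 : ∀ f ∈ 𝔉, Multiset.card (𝔈₁ f) = n ∧ Multiset.card (𝔈₂ f) = n ∧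
      (0 : PadicAlgCl p) ∉ 𝔈₁ f ∧ (0 : PadicAlgCl p) ∉ 𝔈₂ f := by
    intro f hf
    refine ⟨?_, (hB (wv f)).1, ?_, (hB (wv f)).2⟩
    · change Multiset.card (E₁ (wv f) (wα f)) = n
      rw [hE₁def, card_roots_arithFrobPolyOfSatake, (hwα f hf).card_eq]
    · change (0 : PadicAlgCl p) ∉ E₁ (wv f) (wα f)
      exact zero_not_mem_roots_arithFrobPolyOfSatake ι
        (lt_trans zero_lt_one (wv f).one_lt_residueCard) n
        (hasSatakeParamAt_ne_zero_holds (hwα f hf))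
  -- roots of `charpoly (R N σ)` at a Frobenius `σ` over a good place
  have hcomp : ∀ {N : ℕ} (_ : N₀ ≤ N) {σ : absoluteGaloisGroup K} {v : HeightOneSpectrum (𝓞 K)}
      (_ : v ∉ S) {𝔓 : Ideal (absIntegers (𝓞 K) K)} (_ : 𝔓 ∈ v.primesAbove)
      (_ : IsArithFrobAt (𝓞 K) σ 𝔓) {α : Multiset ℂ} (_ : π.HasSatakeParamAt v α),
      (FramedRep.charpoly (R N) σ).roots =
        E₁ v α + (B v).map (· * ((v.residueCard : PadicAlgCl p)⁻¹) ^ (2 * N)) := by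
    intro N hN σ v hv 𝔓 h𝔓 hσ α hα
    rw [((hgood v hv).2.1 α hα N hN).2 𝔓 h𝔓 σ hσ, arithFrobPolyOfSatake_eq_prod_roots,
      multiset_prod_X_sub_C_map (B v), ← Multiset.prod_add, ← Multiset.map_add,
      roots_multiset_prod_X_sub_C]
  -- the family `m ↦ R_{m}` on `ℳ = [N₀, ∞)` and Prop. 7.12
  set ρfam : ℤ → FramedRep (absoluteGaloisGroup K) (PadicAlgCl p) (2 * n) := fun m ↦
    if (N₀ : ℤ) ≤ m then R m.toNat else R N₀ with hρfam_def
  have hρfam : ∀ {m : ℤ}, (N₀ : ℤ) ≤ m → ρfam m = R m.toNat := fun hm ↦ if_pos hm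
  set ℳ : Set ℤ := Set.Ici (N₀ : ℤ) with hℳdef
  have hℳ : ℳ.Infinite := Set.Ici_infinite _
  have hss : ∀ m ∈ ℳ, (ρfam m).toContinuousRep.IsSemisimple := by
    intro m hm
    have hm' : (N₀ : ℤ) ≤ m := hm
    rw [hρfam hm']
    exact hRss _ (by omega)
  have hρ : ∀ m ∈ ℳ, ∀ f ∈ 𝔉, (FramedRep.charpoly (ρfam m) f).roots =
      𝔈₁ f + (𝔈₂ f).map (· * (((μ f) ^ m : (PadicAlgCl p)ˣ) : PadicAlgCl p)) := by
    intro m hm f hf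
    have hm' : (N₀ : ℤ) ≤ m := hm
    rw [hρfam hm', hcomp (by omega) (hwS f hf) (hw𝔓 f hf) (hwσ f hf) (hwα f hf), hμ,
      coe_muS_mk_zpow_of_isArithFrobAt p S hSp (hwS f hf) (hw𝔓 f hf) (hwσ f hf)
        (le_trans (Int.natCast_nonneg N₀) hm')]
  obtain ⟨ρ₁, ρ₂, -, hρ₂ss, hroots⟩ :=
    Literature.NumberTheory.GaloisRepresentations.HarrisLanTaylorThorne2016.prop712Hausdorff_holds
      (absoluteGaloisGroup K) 𝔉 h𝔉 (PadicAlgCl p) n hn μ hμord 𝔈₁ 𝔈₂ h𝔈 ℳ hℳ ρfam hss hρ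
  -- the trace identity on `𝔉`
  have htr : 𝔉 ⊆ {σ | FramedRep.trace (R N) σ = FramedRep.trace ρ σ +
      ((μ σ : (PadicAlgCl p)ˣ) : PadicAlgCl p) ^ N * FramedRep.trace ρ₂ σ} := by
    intro σ hσ
    have h1 := hcomp hN (hwS σ hσ) (hw𝔓 σ hσ) (hwσ σ hσ) (hwα σ hσ)
    have h2 : (FramedRep.charpoly ρ σ).roots = E₁ (wv σ) (wα σ) := by
      change _ = (arithFrobPolyOfSatake ι (wv σ).residueCard n (wα σ)).roots
      rw [((hgood _ (hwS σ hσ)).1 _ (hwα σ hσ)).2 _ (hw𝔓 σ hσ) σ (hwσ σ hσ)]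
    have h3 : (FramedRep.charpoly ρ₂ σ).roots = B (wv σ) := (hroots σ hσ).2
    have h4 : ((μ σ : (PadicAlgCl p)ˣ) : PadicAlgCl p) ^ N =
        (((wv σ).residueCard : PadicAlgCl p)⁻¹) ^ (2 * N) := by
      rw [hμ, coe_muS_mk_of_isArithFrobAt p S hSp (hwS σ hσ) (hw𝔓 σ hσ) (hwσ σ hσ), ← inv_pow,
        ← pow_mul]
    show FramedRep.trace (R N) σ = FramedRep.trace ρ σ + _ * FramedRep.trace ρ₂ σ
    unfold FramedRep.trace
    rw [Matrix.trace_eq_sum_roots_charpoly, Matrix.trace_eq_sum_roots_charpoly,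
      Matrix.trace_eq_sum_roots_charpoly]
    change (FramedRep.charpoly (R N) σ).roots.sum =
      (FramedRep.charpoly ρ σ).roots.sum + _ * (FramedRep.charpoly ρ₂ σ).roots.sum
    rw [h1, h2, h3, h4, Multiset.sum_add, Multiset.sum_map_mul_right, Multiset.map_id', mul_comm]
  -- … hence everywhere, by continuity and density
  have hclosed : IsClosed {σ : absoluteGaloisGroup K | FramedRep.trace (R N) σ =
      FramedRep.trace ρ σ + ((μ σ : (PadicAlgCl p)ˣ) : PadicAlgCl p) ^ N * FramedRep.trace ρ₂ σ} :=
    isClosed_eq (FramedRep.continuous_trace _) ((FramedRep.continuous_trace ρ).add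
      (((Units.continuous_val.comp (map_continuous μ)).pow N).mul (FramedRep.continuous_trace ρ₂)))
  refine ⟨(powMonoidHom N).comp (μ : absoluteGaloisGroup K →* (PadicAlgCl p)ˣ), ρ₂, hρ₂ss,
    fun σ ↦ ?_⟩
  have hmem : σ ∈ closure 𝔉 := by
    rw [h𝔉.closure_eq]
    exact Set.mem_univ σ
  have h := hclosed.closure_subset_iff.2 htr hmem
  rw [Set.mem_setOf_eq] at h
  rw [h, MonoidHom.comp_apply, powMonoidHom_apply, Units.val_pow_eq_pow_val]
  rfl

/-- **`ρ` is a summand of the envelope `R_N` (`N ≥ N₀`)**, cut out by matrices `(I, P)` with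
`P I = 1`: §6.2 followed by §6.1. [cite: HarrisLanTaylorThorneRMS2016, proof of Thm. 7.13 (p. 232)] -/
theorem exists_summand (hn : 0 < n) (π : AutomorphicRepData (AutomorphyDatum.gl n K hcpt))
    (ι : PadicAlgCl p ≃+* ℂ) {N₀ : ℕ} {R : ℕ → FramedGaloisRep K (PadicAlgCl p) (2 * n)}
    {B : HeightOneSpectrum (𝓞 K) → Multiset (PadicAlgCl p)}
    (hRss : ∀ N, N₀ ≤ N → (R N).toGaloisRep.IsSemisimple)
    (hB : ∀ v, Multiset.card (B v) = n ∧ (0 : PadicAlgCl p) ∉ B v)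
    (hRv : ∀ᶠ v : HeightOneSpectrum (𝓞 K) in Filter.cofinite, ∀ α : Multiset ℂ,
      π.HasSatakeParamAt v α → ∀ N, N₀ ≤ N → (R N).IsUnramifiedAt v ∧
        (R N).HasFrobCharpolyAt v (arithFrobPolyOfSatake ι v.residueCard n α *
          ((B v).map fun b ↦ X - C (b * ((v.residueCard : PadicAlgCl p)⁻¹) ^ (2 * N))).prod))
    (ρ : FramedGaloisRep K (PadicAlgCl p) n) (hρss : ρ.toGaloisRep.IsSemisimple)
    (h5 : ∀ᶠ v : HeightOneSpectrum (𝓞 K) in Filter.cofinite, ∀ α : Multiset ℂ,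
      π.HasSatakeParamAt v α → ρ.IsUnramifiedAt v ∧
        ρ.HasFrobCharpolyAt v (arithFrobPolyOfSatake ι v.residueCard n α))
    {N : ℕ} (hN : N₀ ≤ N) :
    ∃ (I : Matrix (Fin (2 * n)) (Fin n) (PadicAlgCl p))
      (P : Matrix (Fin n) (Fin (2 * n)) (PadicAlgCl p)), P * I = 1 ∧
      (∀ g, ((R N g : GL (Fin (2 * n)) (PadicAlgCl p)) : Matrix _ _ (PadicAlgCl p)) * I =
        I * ((ρ g : GL (Fin n) (PadicAlgCl p)) : Matrix _ _ (PadicAlgCl p))) ∧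
      (∀ g, P * ((R N g : GL (Fin (2 * n)) (PadicAlgCl p)) : Matrix _ _ (PadicAlgCl p)) =
        ((ρ g : GL (Fin n) (PadicAlgCl p)) : Matrix _ _ (PadicAlgCl p)) * P) := by
  obtain ⟨χ, ρ₂, hρ₂ss, htr⟩ :=
    exists_trace_decomposition p hn π ι hRss hB hRv ρ h5 hN
  exact exists_summand_of_trace (R N) ρ ρ₂ χ (hRss N hN) hρss hρ₂ss htr

end Global

/-! ### §6.3 The support item -/

open scoped Classical

/-- Restriction to the Weil group of `K_v`, unfolded. [folklore] -/
theorem toWeilGroupHom_toLocal_apply {K : Type} [Field K] [NumberField K] {A : Type*} [CommRing A]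
    [TopologicalSpace A] {d : ℕ} (r : FramedGaloisRep K A d) (v : HeightOneSpectrum (𝓞 K))
    (w : WeilGroup (v.adicCompletion K)) :
    (r.toLocal v).toWeilGroupHom w =
      r (absGaloisRestrict K (v.adicCompletion K) (WeilGroup.toAbsGalois _ w)) := rfl

/-- **stmt-Langlands-2375, proved outright**: the generic-fibre conclusion for the Eisenstein
envelopes implies the existence and genericity of `WD(r_{p,ı}(π)|_{Γ_{K_v}})` at every `v ∤ p`.
For `n > 0`: `ρ = r_{p,ı}(π)` is a summand of `R_N` (`exists_summand`, `N ≥ N₀, N₁`), and the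
recipe datum of `WD(R_N|_{W_{K_v}})` compresses to one for `ρ|_{W_{K_v}}`, generic because
`WD(R_N|v)` is (`exists_isWeilDeligneOfLadic_of_summand`); for `n = 0` the same lemma with
`I = P = 0`. [cite: HarrisLanTaylorThorneRMS2016, proof of Thm. 7.13 (p. 232)] -/
theorem envelopeToTarget : Summit.Langlands.Langlands.Theses.EisensteinMonodromy.EnvelopeToTarget := by
  intro hE K _ _ hCM n hcpt π hreg p _ ι ρ hρss h5 v hvp
  classical
  obtain ⟨N₀, R, B, hRss, hB, hRv, hW⟩ := hE K hCM n hcpt π hreg p ι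
  obtain ⟨N₁, hN₁⟩ := hW v hvp
  rcases Nat.eq_zero_or_pos n with hn | hn
  · subst hn
    obtain ⟨W, hWl, hWg⟩ := hN₁ N₁ le_rfl
    obtain ⟨W', hW'l, hW'g⟩ := exists_isWeilDeligneOfLadic_of_summand
      (ρ' := (ρ.toLocal v).toWeilGroupHom) W (0 : Matrix (Fin (2 * 0)) (Fin 0) (PadicAlgCl p)) 0
      hWl (Subsingleton.elim _ _) (fun _ ↦ Subsingleton.elim _ _) (fun _ ↦ Subsingleton.elim _ _)
    exact ⟨W', hW'l, hW'g hWg⟩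
  · obtain ⟨I, P, hPI, hRI, hPR⟩ :=
      exists_summand p hn π.1 ι hRss hB hRv ρ hρss h5 (le_max_left N₀ N₁)
    obtain ⟨W, hWl, hWg⟩ := hN₁ (max N₀ N₁) (le_max_right _ _)
    obtain ⟨W', hW'l, hW'g⟩ := exists_isWeilDeligneOfLadic_of_summand
      (ρ' := (ρ.toLocal v).toWeilGroupHom) W I P hWl hPI
      (fun w ↦ by rw [toWeilGroupHom_toLocal_apply, toWeilGroupHom_toLocal_apply]; exact hRI _)
      (fun w ↦ by rw [toWeilGroupHom_toLocal_apply, toWeilGroupHom_toLocal_apply]; exact hPR _)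
    exact ⟨W', hW'l, hW'g hWg⟩

end Summit.Langlands.Langlands.Theorems.EisensteinMonodromyEnvelopeToTarget

end
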